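import Summits.ValiantsHypothesis.ValiantsHypothesis.Theorems.BarrierLeverPartitionMinorsMooreBenchCertE

/-!
# Route BarrierLever — item 22038 `ChowBenchmarkPairs`, line `moore_peel`, stub `stub_window`:
# DATA-LIGHT kernel certificates for `det (peelMatrix i) ≠ 0`, part 1 — list arithmetic modulo `p`,
# the (unverified) Gauss–Jordan producer, the verified product check, and the entries of `G_i`

Helper file (`--supports stmt-ValiantsHypothesis-22038`; cell val-lit, seat val-lit-p5 g9; rung V4, 𝒟-side benchmark
of record, registered line `Cruxes/ChowBenchmarkPairs/Lines/moore_peel.lean`, active stub `stub_window := ∀ h ≤ 182,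
MCBenchPairsAt h`).  Closes NO item.

The landed certificates `…MooreBenchCertA–E` (`h ≤ 52`) store the inverse of `G_i = peelMatrix i` modulo a prime as
DATA (≈ 11 KB per `i`) and check it with `ChowFactor.invCertCheck`, whose `List.getD` indexing makes the kernel cost
grow like `i⁴` — unusable towards `i = 182`.  This file and `…WindowCertBTF` replace that by:

* `mulCheck` — the product `A · B ≡ 1 (mod p)` computed row by row as SPARSE row combinations (`rowComb`: zero
  coefficients cost nothing; `G_i` has only `O(i log i)` nonzero entries), with the generic soundness lemma
  **`det_ne_zero_of_mulCheck`**;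
* `inverseRows` — a Gauss–Jordan elimination modulo `p` run BY THE KERNEL (`decide +kernel`, standard axioms, no
  `native_decide`) to produce the candidate inverse: an unverified producer, no lemma about it is needed;
* `gEntry` — the entries of `G_i` as natural numbers (binary digit count `popc` by structural recursion,
  **`peelMatrix_eq_gEntry`**).

Part 2 (`…WindowCertBTF`) adds the block-triangular layer (the peel matrices decompose into diagonal blocks of size
≤ 61 for `i ≤ 182`), part 3 (`…WindowCertF/G/H`) the certificate tables for `53 ≤ i ≤ 182`, and `…Window` assembles
`stub_window`.

WHAT THIS IS NOT: nothing on the ∀h stub `stub_segmentMeanValue`, on items 19717 / 14610, or on `VP` versus `VNP`.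
-/

set_option linter.dupNamespace false
set_option autoImplicit false

namespace Summit.ValiantsHypothesis.ValiantsHypothesis.Theorems.BarrierLever.MoorePeel

open Finset

/-! ## 1. List arithmetic modulo `p` (structural recursion only; evaluated by the kernel) -/

/-- `axpyMod p a b acc = acc + a • b (mod p)`, entrywise; positions missing from `acc` are read as `0`. -/
def axpyMod (p a : ℕ) : List ℕ → List ℕ → List ℕ
  | [], acc => acc
  | y :: ys, [] => (a * y % p) :: axpyMod p a ys []
  | y :: ys, x :: xs => ((x + a * y) % p) :: axpyMod p a ys xs

/-- One step of a row combination: `acc + (a mod p) • b`, doing no work when `a ≡ 0 (mod p)`. -/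
def stepAcc (p a : ℕ) (b acc : List ℕ) : List ℕ :=
  match a % p with
  | 0 => acc
  | k + 1 => axpyMod p (k + 1) b acc

/-- Sparse row combination `acc + Σ_k r_k • B_k (mod p)` (the `k`-th entry of `r` times the `k`-th row of `B`). -/
def rowComb (p : ℕ) : List ℕ → List (List ℕ) → List ℕ → List ℕ
  | a :: as, b :: bs, acc => rowComb p as bs (stepAcc p a b acc)
  | _, _, acc => acc

/-- The zero row of length `n`. -/
def zeroRow (n : ℕ) : List ℕ := List.replicate n 0

/-- The unit row `e_i` of length `n`. -/
def unitRow (n i : ℕ) : List ℕ := (List.range n).map fun t => if t = i then 1 else 0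

/-- **The check**: with `A` the rows of an `n × n` natural matrix and `B` a list of `n` rows,
`A · B ≡ 1 (mod p)` — computed row by row as sparse row combinations and compared with the identity rows. -/
def mulCheck (p n : ℕ) (A B : List (List ℕ)) : Bool :=
  decide (A.map (fun r => rowComb p r B (zeroRow n)) = (List.range n).map (unitRow n))

/-! ## 2. The unverified producer: Gauss–Jordan modulo `p` -/

/-- Modular inverse of `a` by downward search below the fuel (`p` is small). -/
def invSearch (p a : ℕ) : ℕ → ℕ
  | 0 => 0
  | k + 1 => if a * (k + 1) % p = 1 then k + 1 else invSearch p a k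

/-- Find the first row whose current leading (left) entry is nonzero; return it and the remaining rows in order. -/
def findPiv : List (List ℕ × List ℕ) → Option ((List ℕ × List ℕ) × List (List ℕ × List ℕ))
  | [] => none
  | ([], _) :: _ => none
  | (0 :: l, r) :: rest => (findPiv rest).map fun q => (q.1, (0 :: l, r) :: q.2)
  | ((g + 1) :: l, r) :: rest => some (((g + 1) :: l, r), rest)

/-- Clear the current column of one row `(f :: l, r)` with the scaled pivot row `(1 :: plt, pr)`; the cleared
leading entry is dropped. -/
def elimOne (p : ℕ) (plt pr : List ℕ) : List ℕ × List ℕ → List ℕ × List ℕ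
  | ([], r) => ([], r)
  | (0 :: l, r) => (l, r)
  | ((g + 1) :: l, r) => (axpyMod p (p - (g + 1)) plt l, axpyMod p (p - (g + 1)) pr r)

/-- Gauss–Jordan sweep on rows `(left part from the current column on, right part)`; one pivot per unit of fuel.
Returns the right parts in pivot order, i.e. the rows of `A⁻¹ (mod p)` when started on `[A | 1]` with fuel `n`
(and garbage if `A` is singular modulo `p` — the check then fails). -/
def gjLoop (p : ℕ) : ℕ → List (List ℕ × List ℕ) → List (List ℕ × List ℕ) → List (List ℕ)
  | 0, _, done => done.reverse.map Prod.snd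
  | fuel + 1, rows, done =>
    match findPiv rows with
    | none => []
    | some (([], _), _) => []
    | some ((x :: plt, pr), rest) =>
      match invSearch p x (p - 1) with
      | 0 => []
      | s + 1 =>
        gjLoop p fuel
          (rest.map (elimOne p (plt.map fun y => y * (s + 1) % p) (pr.map fun y => y * (s + 1) % p)))
          ((plt.map fun y => y * (s + 1) % p, pr.map fun y => y * (s + 1) % p) ::
            done.map (elimOne p (plt.map fun y => y * (s + 1) % p) (pr.map fun y => y * (s + 1) % p)))

/-- The augmented rows `(A_i mod p, e_i)`. -/
def augment (p n : ℕ) (A : List (List ℕ)) : List (List ℕ × List ℕ) :=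
  (List.range n).map fun i => ((A.getD i []).map (· % p), unitRow n i)

/-- Candidate rows of `A⁻¹` modulo `p` (unverified). -/
def inverseRows (p n : ℕ) (A : List (List ℕ)) : List (List ℕ) := gjLoop p n (augment p n A) []

/-- Producer + check: `A · gj(A) ≡ 1 (mod p)`. -/
def certOK (p n : ℕ) (A : List (List ℕ)) : Bool := mulCheck p n A (inverseRows p n A)

/-! ## 3. Soundness of the check -/

/-- `axpyMod` entrywise modulo `p`: entry `j` of `axpyMod p a b acc` is `acc_j + a · b_j`. -/
theorem axpyMod_getD (p a : ℕ) :
    ∀ (b acc : List ℕ) (j : ℕ),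
      (((axpyMod p a b acc).getD j 0 : ℕ) : ZMod p) = ((acc.getD j 0 : ℕ) : ZMod p) + a * ((b.getD j 0 : ℕ) : ZMod p)
  | [], acc, j => by simp [axpyMod]
  | y :: ys, [], 0 => by simp [axpyMod, ZMod.natCast_mod]
  | y :: ys, [], j + 1 => by
      rw [axpyMod, List.getD_cons_succ, axpyMod_getD p a ys [] j]
      simp
  | y :: ys, x :: xs, 0 => by simp [axpyMod, ZMod.natCast_mod]
  | y :: ys, x :: xs, j + 1 => by
      rw [axpyMod, List.getD_cons_succ, axpyMod_getD p a ys xs j]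
      simp

/-- `stepAcc` entrywise modulo `p`: entry `j` of `stepAcc p a b acc` is `acc_j + a · b_j`. -/
theorem stepAcc_getD (p a : ℕ) (b acc : List ℕ) (j : ℕ) :
    (((stepAcc p a b acc).getD j 0 : ℕ) : ZMod p) = ((acc.getD j 0 : ℕ) : ZMod p) + a * ((b.getD j 0 : ℕ) : ZMod p) := by
  have ha : ((a : ℕ) : ZMod p) = (((a % p : ℕ) : ℕ) : ZMod p) := (ZMod.natCast_mod a p).symm
  unfold stepAcc
  split
  · next h => rw [ha, h]; simp
  · next k h => rw [axpyMod_getD, ha, h]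

/-- `rowComb` entrywise modulo `p`: entry `j` of `rowComb p r B acc` is `acc_j + Σ_{k<N} r_k · (B_k)_j` once `N ≥ |r|`. -/
theorem rowComb_getD (p : ℕ) :
    ∀ (r : List ℕ) (B : List (List ℕ)) (acc : List ℕ) (N : ℕ), r.length ≤ N → ∀ j : ℕ,
      (((rowComb p r B acc).getD j 0 : ℕ) : ZMod p) =
        ((acc.getD j 0 : ℕ) : ZMod p) +
          ∑ k ∈ Finset.range N, ((r.getD k 0 : ℕ) : ZMod p) * (((B.getD k []).getD j 0 : ℕ) : ZMod p)
  | [], B, acc, N, _, j => by simp [rowComb]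
  | a :: as, [], acc, N, _, j => by simp [rowComb]
  | a :: as, b :: bs, acc, 0, h, j => by simp at h
  | a :: as, b :: bs, acc, N + 1, h, j => by
      rw [rowComb, rowComb_getD p as bs (stepAcc p a b acc) N (by simpa using h) j, stepAcc_getD,
        Finset.sum_range_succ']
      simp only [List.getD_cons_succ, List.getD_cons_zero]
      ring

/-- **Check ⇒ nonsingular.**  If an integer matrix `M`, read through the natural row lists `A` (rows of length
`≤ n`), passes `mulCheck p n A B` for some `p > 1`, then `det M ≠ 0`. -/
theorem det_ne_zero_of_mulCheck {n p : ℕ} (hp : 1 < p) (M : Matrix (Fin n) (Fin n) ℤ) (A B : List (List ℕ))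
    (hlen : ∀ r ∈ A, r.length ≤ n) (hA : ∀ i j : Fin n, M i j = ((A.getD i []).getD j 0 : ℕ))
    (h : mulCheck p n A B = true) : M.det ≠ 0 := by
  classical
  haveI : Fact (1 < p) := ⟨hp⟩
  have hEq : A.map (fun r => rowComb p r B (zeroRow n)) = (List.range n).map (unitRow n) :=
    of_decide_eq_true h
  have hAl : A.length = n := by simpa using congrArg List.length hEq
  have hzero : ∀ j : ℕ, (zeroRow n).getD j 0 = 0 := by
    intro j
    by_cases hj : j < n
    · exact List.getD_replicate _ hj
    · exact List.getD_eq_default _ _ (by simpa [zeroRow] using Nat.le_of_not_lt hj)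
  have hij : ∀ i j : Fin n,
      (∑ k ∈ Finset.range n, (((A.getD i []).getD k 0 : ℕ) : ZMod p) * (((B.getD k []).getD j 0 : ℕ) : ZMod p)) =
        if i = j then 1 else 0 := by
    intro i j
    have hi : (i : ℕ) < A.length := hAl ▸ i.2
    have hrow : rowComb p (A.getD i []) B (zeroRow n) = unitRow n i := by
      have h1 := congrArg (fun L : List (List ℕ) => L.getD i []) hEq
      rw [List.getD_eq_getElem _ _ (by simpa using hi), List.getElem_map,
        List.getD_eq_getElem _ _ (by simp), List.getElem_map, List.getElem_range] at h1
      rw [List.getD_eq_getElem _ _ hi]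
      exact h1
    have h2 := rowComb_getD p (A.getD i []) B (zeroRow n) n
      (hlen _ (by rw [List.getD_eq_getElem _ _ hi]; exact List.getElem_mem hi)) j
    rw [hrow, hzero, Nat.cast_zero, zero_add] at h2
    rw [← h2, unitRow, List.getD_eq_getElem _ _ (by simp)]
    simp only [List.getElem_map, List.getElem_range, Fin.val_eq_val]
    by_cases e : j = i
    · subst e; simp
    · rw [if_neg e, if_neg (Ne.symm e), Nat.cast_zero]
  set Bm : Matrix (Fin n) (Fin n) (ZMod p) := fun k j => (((B.getD k []).getD j 0 : ℕ) : ZMod p) with hBm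
  have hmul : (Int.castRingHom (ZMod p)).mapMatrix M * Bm = 1 := by
    ext i j
    rw [Matrix.mul_apply, Matrix.one_apply, ← hij i j,
      ← Fin.sum_univ_eq_sum_range
        (fun k => (((A.getD i []).getD k 0 : ℕ) : ZMod p) * (((B.getD k []).getD j 0 : ℕ) : ZMod p)) n]
    refine Finset.sum_congr rfl fun k _ => ?_
    rw [RingHom.mapMatrix_apply, Matrix.map_apply, hA, hBm]
    simp
  intro hdet
  have h1 : ((Int.castRingHom (ZMod p)).mapMatrix M).det * Bm.det = 1 := by
    rw [← Matrix.det_mul, hmul, Matrix.det_one]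
  rw [← RingHom.map_det, hdet, map_zero, zero_mul] at h1
  exact zero_ne_one h1

/-! ## 4. The peel matrix entries as natural numbers -/

/-- Binary digit count by structural recursion on a fuel (`= popcount` below `2 ^ fuel`). -/
def popc : ℕ → ℕ → ℕ
  | 0, _ => 0
  | f + 1, n => if n = 0 then 0 else n % 2 + popc f (n / 2)

/-- `popcount n = popcount (n / 2) + n % 2`. -/
theorem popcount_eq_div2 (n : ℕ) : popcount n = popcount (n / 2) + n % 2 := by
  rcases Nat.mod_two_eq_zero_or_one n with h | h
  · conv_lhs => rw [show n = 2 * (n / 2) by omega]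
    rw [popcount, popcount, Nat.bitIndices_two_mul, List.length_map, h, add_zero]
  · conv_lhs => rw [show n = 2 * (n / 2) + 1 by omega]
    rw [popcount, popcount, Nat.bitIndices_two_mul_add_one, List.length_cons, List.length_map, h]

/-- `popc` with enough fuel is `popcount`. -/
theorem popc_eq_popcount : ∀ f n : ℕ, n < 2 ^ f → popc f n = popcount n
  | 0, n, h => by
      have : n = 0 := by omega
      subst this
      simp [popc, popcount]
  | f + 1, n, h => by
      rw [popc]
      split
      · next h0 => subst h0; simp [popcount]
      · rw [popc_eq_popcount f (n / 2) (by omega), popcount_eq_div2 n, add_comm]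

/-- The entry `G_i[j, m]` as a natural number (digit counts by `popc`, fuel `c_i + i`). -/
def gEntry (i j m : ℕ) : ℕ :=
  if j &&& (windowStart i + m) = j
  then (popc (windowStart i + i) (windowStart i + m) - popc (windowStart i + i) j).factorial else 0

/-- **The entries of `peelMatrix i` are the naturals `gEntry i`.** -/
theorem peelMatrix_eq_gEntry (i : ℕ) (j m : Fin i) : peelMatrix i j m = ((gEntry i j m : ℕ) : ℤ) := by
  have hlt : windowStart i + i < 2 ^ (windowStart i + i) := Nat.lt_two_pow_self
  have h1 : popc (windowStart i + i) (windowStart i + m) = popcount (windowStart i + m) :=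
    popc_eq_popcount _ _ (lt_trans (by omega) hlt)
  have h2 : popc (windowStart i + i) j = popcount j := popc_eq_popcount _ _ (lt_trans (by omega) hlt)
  rw [peelMatrix, Matrix.of_apply, gEntry, h1, h2]
  split_ifs <;> simp

end Summit.ValiantsHypothesis.ValiantsHypothesis.Theorems.BarrierLever.MoorePeel
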